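import Summits.CriticalPhenomena.PercolationContinuityZ3.Theorems.PercNearOneGluingNoHeavyLowerTailCovTauA2EdgeAnti
import Summits.CriticalPhenomena.PercolationContinuityZ3.Theorems.PercNearOneGluingNoHeavyLowerTailCovTauStarBridgeEdge
import HarnessLib

/-!
# Crux `NoHeavyLowerTail` (stmt-CriticalPhenomena-4575): the two-source inequality (A2) and P1 ≥ 0 — UNCONDITIONAL
# (the A2 route to COV(τ) closed)

Support file (`--supports stmt-CriticalPhenomena-4575`, prover prim-hp-4 gen 9).  No named facts, no sorries, no
`Prop` definitions, no hypotheses beyond the setting.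

The A2 route to the conditioned covariance transfer COV(τ) (prim-hp-8's COV-TAU-PROOF) is now closed in the tree:
* one-source bounds (★_N) and (Y ≤ B) in every world — `CovTauStarN.yfE_mul_mf_le`, `CovTauStarN.yfE_le_bfE`
  (prim-ineq-prove-1: Gladkov's decision-tree Harris–Kleitman inequality along the set-rooted cluster exploration of
  prim-ineq-gen-6's `SetClusterExploration`, real layer cake, vdBHK Thm. 1.4);
* two-source induction — `CovTau.a2E` / `CovTau.p1E` (prim-hp-4: vdBHK-Thm-1.1-type induction on the vertex set with
  `BHK2006.core`, star decompositions, product law of the neighbour set, Ahlswede–Daykin; `Y` antitone via the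
  cluster-value decoupling);
* assembly — `CovTau.covTau_of_sumForm` (prim-gen-induct: two-cluster Gibbs-sampler reduction, world-wise 4PT, closure
  over degenerate weights, dictionary to the sum form).
THIS FILE records the unconditional statements:
* `CovTau.a2E_holds` — (A2) `E_U(N)·Y_U(N') ≤ M_U(N ∪ N')·X_U(N ∩ N')` for every weight in `[0,1]`, every `U`, all
  `N, N' ⊆ U`, every monotone `g ≥ 0` on edge sets (the first Lean proof of hp-8's Lemma A2 in full, not only its diagonal);
* `CovTau.p1E_holds` — its diagonal (P1 ≥ 0);
* COV(τ) itself by THIS route is `CovTau.covTau_of_oneSource` (`…CovTauA2OneSource.lean`) with its two hypotheses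
  discharged by `CovTauStarN.yfE_mul_mf_le` / `yfE_le_bfE` — an independent second proof of the statement already landed
  as prim-hp-7's `CovTau.covTau` (`…CovTauOfTA.lean`, hull-port `T_A` chain), so it is not restated here (D-dedup);
  downstream (landed by the cell): `CovTau.covTransfer_of_covTau` ⇒ `SurplusTransfer.surplusTransfer_pair_of_covTransfer`
  ((S5)₂) ⇒ `gen_triple_of_covTransfer` ((GEN), three relays) ⇒ Kozma–Nitzan's Conjecture 1 for `|A| ≤ 3`
  (`CondGluing.kozmaNitzan_conjecture1_card_le_three`).
[cite: VandenbergHaggstromKahn2005, Thm. 1.1 (pp. 3–5), Thms. 1.3–1.4 (pp. 6–7), §2.1 (pp. 9–13)]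
[cite: Gladkov2024, Thm. 3.2] [cite: KozmaNitzan2024, Conj. 1 (p. 3)]
-/

noncomputable section

namespace Summit.CriticalPhenomena.PercolationContinuityZ3.Theorems.CovTau

open MeasureTheory
open Literature.Probability.LatticeModels (prodBernoulli)
open Literature.Probability.Percolation
open Literature.Probability.Percolation.BHK2006
open scoped Classical

variable {V : Type*} [Fintype V]

/-- **Lemma A2 (two sources), unconditional**: for weights `w ∈ [0,1]` with total mass `1`, owner `x`, observers
`o, v`, a monotone `g ≥ 0` on edge sets, a vertex set `U` and `N, N' ⊆ U`:
`E_U(N)·Y_U(N') ≤ M_U(N ∪ N')·X_U(N ∩ N')` (prim-hp-8's COV-TAU-PROOF §4, Lemma A2).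
[cite: VandenbergHaggstromKahn2005, Thm. 1.1 (pp. 3–5)] [cite: Gladkov2024, Thm. 3.2] -/
theorem a2E_holds (w : Sym2 V → ℝ) (hw0 : ∀ e, 0 ≤ w e) (hw1 : ∀ e, w e ≤ 1)
    (hm : ∑ ω, weight w ω = 1) (x o v : V) {g : Set (Sym2 V) → ℝ}
    (hg : Monotone g) (hg0 : ∀ C, 0 ≤ g C) (U : Finset V) {N N' : Set V} (hNU : N ⊆ ↑U) (hN'U : N' ⊆ ↑U) :
    Ef w U x o v N * YfE w U x v g N' ≤ Mf w U x v (N ∪ N') * XfE w U x o v g (N ∩ N') :=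
  a2E w hw0 hw1 hm x o v hg hg0 U
    (fun U' _ N _ => CovTauStarN.yfE_mul_mf_le w hw0 hw1 x v hg hg0 U' N)
    (fun U' _ u => CovTauStarN.yfE_le_bfE w hw0 hw1 x v hg hg0 U' {u}) hNU hN'U

/-- **P1 ≥ 0, unconditional** (the diagonal `N = N' = {y}` of Lemma A2):
`E_U({y})·Y_U({y}) ≤ M_U({y})·X_U({y})`, i.e. `E_π[(q(C_y) − τ)·B(C_y)] ≥ 0` (COV-TAU-PROOF §5(a)).
[cite: VandenbergHaggstromKahn2005, Thm. 1.1 (pp. 3–5)] [cite: Gladkov2024, Thm. 3.2] -/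
theorem p1E_holds (w : Sym2 V → ℝ) (hw0 : ∀ e, 0 ≤ w e) (hw1 : ∀ e, w e ≤ 1)
    (hm : ∑ ω, weight w ω = 1) (x o v y : V) {g : Set (Sym2 V) → ℝ}
    (hg : Monotone g) (hg0 : ∀ C, 0 ≤ g C) (U : Finset V) (hy : y ∈ U) :
    Ef w U x o v {y} * YfE w U x v g {y} ≤ Mf w U x v {y} * XfE w U x o v g {y} :=
  p1E w hw0 hw1 hm x o v y hg hg0 U hy
    (fun U' _ N _ => CovTauStarN.yfE_mul_mf_le w hw0 hw1 x v hg hg0 U' N)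
    (fun U' _ u => CovTauStarN.yfE_le_bfE w hw0 hw1 x v hg hg0 U' {u})

end Summit.CriticalPhenomena.PercolationContinuityZ3.Theorems.CovTau
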